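import Summits.Parity.GeneralizedHardyLittlewood.Theorems.LeeYangFibresCellParityLawDefs
import Summits.Parity.GeneralizedHardyLittlewood.Theorems.LeeYangFibresCellParityLawSingularRatio
import Literature.NumberTheory.Sieve.LinearEquationsInPrimesProofs
import Literature.NumberTheory.Sieve.LinearEquationsInPrimesLocalObstruction
import Literature.NumberTheory.Sieve.LinearEquationsInPrimesSubsystems
import HarnessLib

/-!
# Route `LeeYangFibres`, crux `CellParityLaw` (stmt-Parity-14109), line `section-annihilator`:
# the registered stub `stub_eulerRatio` — the Euler-ratio identity

We prove `EulerRatioIdentity` (vocabulary file `LeeYangFibresCellParityLawDefs`, skeleton v8): for a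
non-degenerate one-dimensional system `Ψ = (ψ₀, …, ψ_t)` of `t + 1` affine-linear forms
`ψ_k(n) = a_k n + b_k` of size `‖Ψ‖_N ≤ L` at scale `N ≥ N₀(t, L, u) := (max(t, L) + 2)^u`, and a
coordinate `i` (sub-system `Ψ₋ᵢ = Fin.removeNth i Ψ`):

* (a) if `𝔖(Ψ₋ᵢ) ≠ 0`, Bombieri's constant `H_{Ψ,i} = ∏_p (1 - g_{Ψ,i}(p))(1 - 1/p)⁻¹` of the section
  density `g = sectionDensity Ψ i` (the ordered limit `sectionH Ψ i`) equals `𝔖(Ψ)/𝔖(Ψ₋ᵢ)`;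
* (b) if `𝔖(Ψ₋ᵢ) = 0`, every section mass `sectionMass Ψ K N u i j' 1` vanishes.

Proof of (a): PRIME BY PRIME, an exact identity. With `g_p = goodCount Ψ p`, `g'_p = goodCount Ψ₋ᵢ p`
(`g_p ≤ g'_p`) one has `ν_p(Φ) = zeroCount Φ p = p - goodCount Φ p` (the residues `c mod p` killed by
some form, counted on `range p` or on `(ℤ/p)^1`), so `g_{Ψ,i}(p) = (g'_p - g_p)/g'_p`; by Green–Tao's
`β_p = p⁻¹ (p/(p-1))^s goodCount` (`localFactor_prime`, `s = t + 1` and `s = t`) this gives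
`(1 - g_{Ψ,i}(p))(1 - 1/p)⁻¹ β_p(Ψ₋ᵢ) = β_p(Ψ)` (both sides `0` when `g'_p = 0`, where Lean's `x/0 = 0`
makes `g_{Ψ,i}(p) = 0`). Hence `(∏_{p ≤ x} E_p) · ∏_{p ≤ x} β_p(Ψ₋ᵢ) = ∏_{p ≤ x} β_p(Ψ)` for every `x`,
and the limits of Green–Tao 2010, Lemma 1.3 (`tendsto_singularProductPartial_holds`, for `Ψ` and for
`Ψ₋ᵢ`) identify `limUnder`.

Proof of (b): if `𝔖(Ψ₋ᵢ) = 0` then some local factor `β_p(Ψ₋ᵢ)` vanishes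
(`singularProduct_pos_of_localFactor_pos`), i.e. `goodCount Ψ₋ᵢ p = 0`: every residue is a zero of
some `ψ_k`, `k ≠ i`. Such a prime has `p ≤ max(t, L)`: for `p > L` all leading coefficients are units
mod `p` (`coeff_ne_zero_mod_of_affLinSize_le`) and `t` forms kill at most `t` residues
(`le_goodCount_add`). For `N ≥ (max(t,L) + 2)^u` one has `N^{1/u} ≥ max(t, L) + 2 > p` and `≥ 2`, so no
lattice point `n` can have all `ψ_k(n)` (`k ≠ i`) `N^{1/u}`-rough: the form divisible by `p` has
`P⁻(ψ_k(n)) ≤ p` if `ψ_k(n) > 0` and `P⁻(0) = 2` (Lean's `Nat.minFac 0`) otherwise.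

References: B. Green, T. Tao, *Linear equations in primes*, Ann. of Math. 171 (2010), Lemma 1.3,
(1.6)–(1.7) and the sentence following Lemma 1.3 [GreenTao2010]; E. Bombieri, RIMS Kokyuroku 294
(1977) p. 5 (the constant `H`) [BombieriRIMS1977].
-/

noncomputable section

open scoped BigOperators Topology Classical
open Finset Filter Literature.NumberTheory.Sieve

namespace Summit.Parity.GeneralizedHardyLittlewood.Cruxes.CellParityLaw.SectionAnnihilator

namespace EulerRatioAux

variable {t : ℕ}

/-! ## `ν_p = p - goodCount`: zero counts versus good counts -/

/-- Membership in the range `{0, …, p-1} ⊆ ℤ` of the vocabulary file's `zeroCount` (the finset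
`Finset.range p` pushed into `ℤ` through the `Finset` monad, as the definition elaborates). -/
theorem mem_coeM_range (p : ℕ) (c : ℤ) :
    c ∈ (do let a ← Finset.range p; pure (a : ℤ) : Finset ℤ) ↔ ∃ a : ℕ, a < p ∧ (a : ℤ) = c := by
  simp only [Bind.bind, pure, Finset.mem_sup, Finset.mem_singleton, Finset.mem_range]
  constructor
  · rintro ⟨a, ha, rfl⟩
    exact ⟨a, ha, rfl⟩
  · rintro ⟨a, ha, rfl⟩
    exact ⟨a, ha, rfl⟩

/-- The zero count of the vocabulary file, read on `(ℤ/p)^1`: `c ↦ (c mod p)` is a bijection from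
`{0, …, p-1} ⊆ ℤ` onto `(ℤ/p)^1` matching "some `ψ_k(c) ≡ 0 (mod p)`" with "some `ψ_k` vanishes at
the residue" (`AffLinForm.intCast_eval`). -/
theorem zeroCount_eq_card {s : ℕ} (Φ : Fin s → AffLinForm 1) (p : ℕ) [NeZero p] :
    zeroCount Φ p = #{v : Fin 1 → ZMod p | ∃ k, (Φ k).modEval p v = 0} := by
  have key : ∀ c : ℤ, (∃ k, (p : ℤ) ∣ (Φ k).eval (fun _ => c)) ↔
      ∃ k, (Φ k).modEval p (fun _ => (c : ZMod p)) = 0 := fun c => by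
    refine exists_congr fun k => ?_
    rw [← ZMod.intCast_zmod_eq_zero_iff_dvd, AffLinForm.intCast_eval]
  unfold zeroCount
  refine Finset.card_nbij' (fun c => fun _ => ((c : ℤ) : ZMod p)) (fun v => ((v 0).val : ℤ))
    (fun c hc => ?_) (fun v hv => ?_) (fun c hc => ?_) (fun v _ => ?_)
  · rw [Finset.mem_coe, Finset.mem_filter] at hc ⊢
    exact ⟨Finset.mem_univ _, (key c).mp hc.2⟩
  · rw [Finset.mem_coe, Finset.mem_filter] at hv ⊢
    have hv0 : (fun _ : Fin 1 => ((((v 0).val : ℕ) : ℤ) : ZMod p)) = v := by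
      funext k
      rw [Int.cast_natCast, ZMod.natCast_zmod_val, Fin.fin_one_eq_zero k]
    refine ⟨(mem_coeM_range p _).mpr ⟨(v 0).val, ZMod.val_lt _, rfl⟩, (key _).mpr ?_⟩
    rw [hv0]
    exact hv.2
  · rw [Finset.mem_coe, Finset.mem_filter] at hc
    obtain ⟨a, ha, rfl⟩ := (mem_coeM_range p c).mp hc.1
    show ((((a : ℤ) : ZMod p)).val : ℤ) = a
    rw [Int.cast_natCast, ZMod.val_cast_of_lt ha]
  · funext k
    rw [Fin.fin_one_eq_zero k]
    show ((((v 0).val : ℕ) : ℤ) : ZMod p) = v 0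
    rw [Int.cast_natCast, ZMod.natCast_zmod_val]

/-- `goodCount Φ p + zeroCount Φ p = p`: a residue is either good for every form or a zero of some
form (`card_filter_forall_not_add` on `(ℤ/p)^1`, of cardinality `p`). -/
theorem goodCount_add_zeroCount {s : ℕ} (Φ : Fin s → AffLinForm 1) (p : ℕ) [NeZero p] :
    goodCount Φ p + zeroCount Φ p = p := by
  -- the `∃`-filter is taken from the lemma (its decidability instance), then matched by `convert`
  have hG : goodCount Φ p + _ = Fintype.card (Fin 1 → ZMod p) :=
    card_filter_forall_not_add (fun k v => (Φ k).modEval p v = 0)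
  rw [card_zmod_pow p 1, pow_one] at hG
  rw [zeroCount_eq_card]
  convert hG using 4

/-- `ν_p(Φ) = p - goodCount Φ p` in `ℝ`. -/
theorem zeroCount_eq_sub {s : ℕ} (Φ : Fin s → AffLinForm 1) (p : ℕ) [NeZero p] :
    (zeroCount Φ p : ℝ) = p - goodCount Φ p := by
  have h := congrArg (Nat.cast (R := ℝ)) (goodCount_add_zeroCount Φ p)
  push_cast at h
  linarith

/-! ## The telescoping identity, prime by prime -/

/-- At a prime `p` the section density is `(g'_p - g_p)/g'_p` with `g_p = goodCount Ψ p`,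
`g'_p = goodCount Ψ₋ᵢ p` (`p.primeFactors = {p}` and `ν_p = p - goodCount`). -/
theorem sectionDensity_prime (Ψ : Fin (t + 1) → AffLinForm 1) (i : Fin (t + 1)) {p : ℕ}
    [hp : Fact p.Prime] :
    sectionDensity Ψ i p =
      ((goodCount (Fin.removeNth i Ψ) p : ℝ) - goodCount Ψ p) / goodCount (Fin.removeNth i Ψ) p := by
  unfold sectionDensity
  rw [hp.out.primeFactors, Finset.prod_singleton, zeroCount_eq_sub Ψ p,
    zeroCount_eq_sub (Fin.removeNth i Ψ) p]
  ring

/-- **The Euler factor identity** `(1 - g_{Ψ,i}(p))(1 - 1/p)⁻¹ · β_p(Ψ₋ᵢ) = β_p(Ψ)` at every prime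
`p` (from `localFactor_prime` for `Ψ` and `Ψ₋ᵢ`; when `goodCount Ψ₋ᵢ p = 0` both sides vanish). -/
theorem eulerFactor_mul_localFactor (Ψ : Fin (t + 1) → AffLinForm 1) (i : Fin (t + 1)) {p : ℕ}
    (hp : p.Prime) :
    (1 - sectionDensity Ψ i p) / (1 - (p : ℝ)⁻¹) * localFactor (Fin.removeNth i Ψ) p =
      localFactor Ψ p := by
  haveI := Fact.mk hp
  have hp2 : (2 : ℝ) ≤ p := by exact_mod_cast hp.two_le
  have hp0 : (p : ℝ) ≠ 0 := Nat.cast_ne_zero.mpr hp.ne_zero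
  have hp1 : (p : ℝ) - 1 ≠ 0 := ne_of_gt (by linarith)
  have hle : goodCount Ψ p ≤ goodCount (Fin.removeNth i Ψ) p :=
    SingularRatio.goodCount_le_removeNth Ψ i p
  rw [sectionDensity_prime Ψ i, localFactor_prime, localFactor_prime, pow_one, pow_succ]
  by_cases hG' : goodCount (Fin.removeNth i Ψ) p = 0
  · have hG : goodCount Ψ p = 0 := Nat.eq_zero_of_le_zero (hG' ▸ hle)
    simp [hG, hG']
  · have hG'r : (goodCount (Fin.removeNth i Ψ) p : ℝ) ≠ 0 := Nat.cast_ne_zero.mpr hG'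
    field_simp
    ring

/-- The partial products telescope exactly:
`(∏_{p ≤ x} (1 - g(p))(1 - 1/p)⁻¹) · ∏_{p ≤ x} β_p(Ψ₋ᵢ) = ∏_{p ≤ x} β_p(Ψ)`. -/
theorem prod_eulerFactor_mul (Ψ : Fin (t + 1) → AffLinForm 1) (i : Fin (t + 1)) (x : ℕ) :
    (∏ p ∈ Nat.primesLE x, (1 - sectionDensity Ψ i p) / (1 - (p : ℝ)⁻¹)) *
        singularProductPartial (Fin.removeNth i Ψ) x = singularProductPartial Ψ x := by
  unfold singularProductPartial
  rw [← Finset.prod_mul_distrib]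
  exact Finset.prod_congr rfl fun p hp =>
    eulerFactor_mul_localFactor Ψ i (Nat.prime_of_mem_primesLE hp)

/-! ## Part (a): the limit -/

/-- **`H_{Ψ,i} = 𝔖(Ψ)/𝔖(Ψ₋ᵢ)` off local obstructions**: if `𝔖(Ψ₋ᵢ) ≠ 0` the partial products
`∏_{p ≤ x} β_p(Ψ₋ᵢ) → 𝔖(Ψ₋ᵢ)` are eventually non-zero, so the Euler partial products equal
`∏_{p ≤ x} β_p(Ψ) / ∏_{p ≤ x} β_p(Ψ₋ᵢ) → 𝔖(Ψ)/𝔖(Ψ₋ᵢ)` (Green–Tao 2010, Lemma 1.3 twice), and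
`limUnder` is this limit. -/
theorem sectionH_eq (Ψ : Fin (t + 1) → AffLinForm 1) (hΨ : IsNondegenerateSystem Ψ)
    (i : Fin (t + 1)) (hne : singularProduct (Fin.removeNth i Ψ) ≠ 0) :
    sectionH Ψ i = singularProduct Ψ / singularProduct (Fin.removeNth i Ψ) := by
  have hP := tendsto_singularProductPartial_holds 1 (t + 1) Ψ hΨ
  have hP' := tendsto_singularProductPartial_holds 1 t (Fin.removeNth i Ψ)
    (SingularRatio.isNondegenerateSystem_removeNth hΨ i)
  have hlim : Tendsto
      (fun x : ℕ => ∏ p ∈ Nat.primesLE x, (1 - sectionDensity Ψ i p) / (1 - (p : ℝ)⁻¹))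
      atTop (𝓝 (singularProduct Ψ / singularProduct (Fin.removeNth i Ψ))) := by
    refine (hP.div hP' hne).congr' ?_
    filter_upwards [hP'.eventually_ne hne] with x hx
    rw [Pi.div_apply, div_eq_iff hx]
    exact (prod_eulerFactor_mul Ψ i x).symm
  unfold sectionH
  exact hlim.limUnder_eq

/-! ## Part (b): local obstructions of the sub-system -/

/-- **A local obstruction of `Ψ₋ᵢ` sits at a small prime**: if `𝔖(Ψ₋ᵢ) = 0` then some prime
`p ≤ max(t, L)` has `goodCount Ψ₋ᵢ p = 0` (a vanishing `β_p`, by `singularProduct_pos_of_localFactor_pos`;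
`p ≤ L` or else unit leading coefficients and `le_goodCount_add` force `p ≤ t`), so every lattice
point has one of the forms `ψ_k`, `k ≠ i`, divisible by `p`. -/
theorem exists_small_prime_dvd (Ψ : Fin (t + 1) → AffLinForm 1) (hΨ : IsNondegenerateSystem Ψ)
    {L N : ℕ} (hL : affLinSize Ψ N ≤ L) (i : Fin (t + 1))
    (h0 : singularProduct (Fin.removeNth i Ψ) = 0) :
    ∃ p : ℕ, p.Prime ∧ p ≤ max t L ∧
      ∀ n : Fin 1 → ℤ, ∃ k : Fin t, (p : ℤ) ∣ (Ψ (i.succAbove k)).eval n := by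
  have hΦ := SingularRatio.isNondegenerateSystem_removeNth hΨ i
  obtain ⟨p, hp, hβ⟩ : ∃ p : ℕ, p.Prime ∧ ¬ 0 < localFactor (Fin.removeNth i Ψ) p := by
    by_contra h
    push Not at h
    exact (singularProduct_pos_of_localFactor_pos _ hΦ h).ne' h0
  haveI := Fact.mk hp
  have hG : goodCount (Fin.removeNth i Ψ) p = 0 := by
    have h := mt (goodCount_pos_iff_localFactor_pos (Fin.removeNth i Ψ) hp).mp hβ
    omega
  refine ⟨p, hp, ?_, fun n => ?_⟩
  · by_contra hlt
    push Not at hlt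
    have hLp : L < p := lt_of_le_of_lt (le_max_right t L) hlt
    have htp : t < p := lt_of_le_of_lt (le_max_left t L) hlt
    have h := le_goodCount_add (Fin.removeNth i Ψ) p
      (coeff_ne_zero_mod_of_affLinSize_le hΦ ((affLinSize_removeNth_le Ψ i (N : ℝ)).trans hL) hLp)
    omega
  · have hv : ¬ ∀ k, ¬ (Fin.removeNth i Ψ k).modEval p (fun j => ((n j : ℤ) : ZMod p)) = 0 := by
      intro hall
      have hpos : 0 < goodCount (Fin.removeNth i Ψ) p :=
        Finset.card_pos.mpr ⟨_, Finset.mem_filter.mpr ⟨Finset.mem_univ _, hall⟩⟩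
      omega
    push Not at hv
    obtain ⟨k, hk⟩ := hv
    refine ⟨k, ?_⟩
    rw [← ZMod.intCast_zmod_eq_zero_iff_dvd, AffLinForm.intCast_eval]
    exact hk

/-- **Empty sections on a local obstruction**: if every lattice point has a form `ψ_k`, `k ≠ i`,
divisible by a prime `p < N^{1/u}`, and `2 ≤ N^{1/u}`, then no lattice point has all `ψ_k(n)`
(`k ≠ i`) `N^{1/u}`-rough (`P⁻(m) ≤ p` for `p ∣ m > 0`, `P⁻(0) = 2`), so `sectionMass … 1 = 0`. -/
theorem sectionMass_eq_zero (Ψ : Fin (t + 1) → AffLinForm 1) (i : Fin (t + 1)) {N u p : ℕ}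
    (hp : p.Prime) (hpN : (p : ℝ) < (N : ℝ) ^ ((1 : ℝ) / u))
    (h2N : (2 : ℝ) ≤ (N : ℝ) ^ ((1 : ℝ) / u))
    (hdiv : ∀ n : Fin 1 → ℤ, ∃ k : Fin t, (p : ℤ) ∣ (Ψ (i.succAbove k)).eval n)
    (K : Set (Fin 1 → ℝ)) (j' : Fin t → ℕ) : sectionMass Ψ K N u i j' 1 = 0 := by
  unfold sectionMass
  rw [Finset.card_eq_zero, Finset.filter_eq_empty_iff]
  rintro n - ⟨-, -, -, hall⟩
  obtain ⟨k, hk⟩ := hdiv n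
  obtain ⟨hlt, -⟩ := hall k
  rcases le_or_gt ((Ψ (i.succAbove k)).eval n) 0 with hm | hm
  · rw [Int.toNat_of_nonpos hm, Nat.minFac_zero, Nat.cast_ofNat] at hlt
    linarith
  · have hpd : p ∣ ((Ψ (i.succAbove k)).eval n).toNat := by
      rw [← Int.natCast_dvd_natCast, Int.toNat_of_nonneg hm.le]
      exact hk
    have h1 : (Nat.minFac ((Ψ (i.succAbove k)).eval n).toNat : ℝ) ≤ p := by
      exact_mod_cast Nat.minFac_le_of_dvd hp.two_le hpd
    linarith

end EulerRatioAux

open EulerRatioAux in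
/-- **`stub_eulerRatio`** (registered stub of the line `section-annihilator`, skeleton v8): the
Euler-ratio identity `EulerRatioIdentity` — for `N ≥ (max(t, L) + 2)^u`, non-degenerate `(t+1)`-form
systems of size `≤ L` and every coordinate `i`: `H_{Ψ,i} = 𝔖(Ψ)/𝔖(Ψ₋ᵢ)` if `𝔖(Ψ₋ᵢ) ≠ 0`
(prime-by-prime telescoping and Green–Tao 2010, Lemma 1.3), and every section mass vanishes if
`𝔖(Ψ₋ᵢ) = 0` (local obstruction at a prime `p ≤ max(t, L) < N^{1/u}`). -/
theorem stub_eulerRatio : EulerRatioIdentity := by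
  intro t L u hu
  refine ⟨(max t L + 2) ^ u, fun N hN Ψ hΨ hL i =>
    ⟨fun hne => sectionH_eq Ψ hΨ i hne, fun h0 K j' => ?_⟩⟩
  obtain ⟨p, hp, hpM, hdiv⟩ := exists_small_prime_dvd Ψ hΨ hL i h0
  have hroot : ((max t L + 2 : ℕ) : ℝ) ≤ (N : ℝ) ^ ((1 : ℝ) / u) := by
    -- `M ≤ N^{1/u}` from `M^u ≤ N` (as `RoughTuple.le_rpow_of_pow_le` of
    -- `LinearFormsRoughTupleBound`, inlined to keep the import closure of the line small)
    have hM : (0 : ℝ) ≤ ((max t L + 2 : ℕ) : ℝ) := Nat.cast_nonneg _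
    calc ((max t L + 2 : ℕ) : ℝ) = ((((max t L + 2 : ℕ) : ℝ) ^ u)) ^ ((1 : ℝ) / u) := by
          rw [one_div, Real.pow_rpow_inv_natCast hM (by omega)]
      _ ≤ (N : ℝ) ^ ((1 : ℝ) / u) :=
          Real.rpow_le_rpow (by positivity) (by exact_mod_cast hN) (by positivity)
  have hp2 : (p : ℝ) + 2 ≤ ((max t L + 2 : ℕ) : ℝ) := by
    exact_mod_cast (by omega : p + 2 ≤ max t L + 2)
  have hp0 : (0 : ℝ) ≤ p := Nat.cast_nonneg p
  exact sectionMass_eq_zero Ψ i hp (by linarith) (by linarith) hdiv K j'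

end Summit.Parity.GeneralizedHardyLittlewood.Cruxes.CellParityLaw.SectionAnnihilator

end
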